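import Literature.Computability.MetaComplexity.EFPlainHZ
import HarnessLib

/-!
# Plain ripple-carry arithmetic: the commutativity kit of integer multiplication

Layer P/5. Towards `M(a, b) ≡ M(b, a)` bitwise for the shift-and-add multiplier
(`EFPlainMul.lean`). The KIT `Plain.Comm.commPT L` on the inputs `a, b, zz` (`2L + 1` inputs):
the multipliers `M_k = M(a⁽ᵏ⁾, b)` of the truncations `a⁽ᵏ⁾` (bits `< k` of `a`, else the
zero gate) for `k ≤ L`, the multiplier `M' = M(b, a)`, the rows `QR_k` of gates
`g_{k,j} = a_k ∧ (b << k)_j`, the adders `U_{k,t} = R_t(M_k) + Qw_{k,t}` (`Qw_{k,t}` the word of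
the `g_{k,j}` for `k ≤ j < k + t`, else zero) and the plain interchange kits `F_{k,t}` on
`(R_t(M_k), Qw_{k,t}, mask_t(M_k), δw_{k,t})` (`δw_{k,t}` the one-hot word of `g_{k,k+t}`).
This file: layout, views, availability, sub-kit inputs. The law is in `EFPlainCommLaw.lean`.

## Sources

* H. Vollmer, *Introduction to Circuit Complexity* (Springer 1999), §1.2.
* S. A. Cook, R. A. Reckhow, *The relative efficiency of propositional proof systems*,
  J. Symbolic Logic 44 (1979), §2.
-/

namespace Literature.Computability.MetaComplexity

open _root_.Computability Complexity Complexity.PropForm Netlist Cluster FregeSystem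

namespace Plain

/-- Length of the interchange kit. [folklore] -/
theorem MFI.length_mfiT (W : ℕ) : (MFI.mfiT W).length = 14 * MFI.A W := by
  rw [MFI.mfiT, length_layout, MFI.offset_pieces]

namespace Comm

variable (L : ℕ)

/-! ### Lengths and offsets -/

/-- Length of a multiplier. [folklore] -/
def MLn (L : ℕ) : ℕ := L * Mul.PS L
/-- Length of an interchange kit. [folklore] -/
def MF (L : ℕ) : ℕ := 14 * MFI.A L
/-- Offset of the rows `QR_k`. [folklore] -/
def oQ (L : ℕ) : ℕ := (L + 2) * MLn L
/-- Offset of the adders `U_{k,t}`. [folklore] -/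
def oU (L : ℕ) : ℕ := oQ L + L * L
/-- Offset of the interchange kits `F_{k,t}`. [folklore] -/
def oF (L : ℕ) : ℕ := oU L + L * (L + 1) * MFI.A L
/-- The piece index of the first interchange kit. [folklore] -/
def iF (L : ℕ) : ℕ := 2 * L + 2 + L * (L + 1)
/-- The number of pieces. [folklore] -/
def NP (L : ℕ) : ℕ := iF L + L * L

/-! ### References -/

/-- Bit `j` of `R_t(M_k)` (`R_0` is the zero gate). [folklore] -/
def RRefM (k t j : ℕ) : ℕ ⊕ ℕ := if t = 0 then Sum.inl (2 * L) else Sum.inr (k * MLn L + ((t - 1) * Mul.PS L + L + (2 * j + 1)))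
/-- Gate `g_{k,j}`. [folklore] -/
def gRef (k j : ℕ) : ℕ ⊕ ℕ := Sum.inr (oQ L + k * L + j)
/-- Bit `j` of `Qw_{k,t}`. [folklore] -/
def QwRef (k t j : ℕ) : ℕ ⊕ ℕ := if k ≤ j ∧ j < k + t then gRef L k j else Sum.inl (2 * L)
/-- Bit `j` of `δw_{k,t}`. [folklore] -/
def dRef (k t j : ℕ) : ℕ ⊕ ℕ := if j = k + t then gRef L k j else Sum.inl (2 * L)
/-- Gate of `mask_t(M_k)` at bit `j`. [folklore] -/
def mkRef (k t j : ℕ) : ℕ ⊕ ℕ := Sum.inr (k * MLn L + (t * Mul.PS L + j))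

/-! ### Wirings -/

/-- `M_k`. [folklore] -/
def wM (k : ℕ) (i : ℕ) : ℕ ⊕ ℕ := if i < L then (if i < k then Sum.inl i else Sum.inl (2 * L)) else if i < 2 * L then Sum.inl i else Sum.inl (2 * L)
/-- `M'`. [folklore] -/
def wMP (i : ℕ) : ℕ ⊕ ℕ := if i < L then Sum.inl (L + i) else if i < 2 * L then Sum.inl (i - L) else Sum.inl (2 * L)
/-- `QR_k`. [folklore] -/
def wQ (k : ℕ) (j : ℕ) : ℕ ⊕ ℕ := if j = 0 then Sum.inl k else if k ≤ j - 1 then Sum.inl (L + (j - 1 - k)) else Sum.inl (2 * L)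
/-- `U_{k,t}`. [folklore] -/
def wU (k t : ℕ) (j : ℕ) : ℕ ⊕ ℕ := if j < L then RRefM L k t j else QwRef L k t (j - L)
/-- `F_{k,t}`. [folklore] -/
def wF (k t : ℕ) (i : ℕ) : ℕ ⊕ ℕ :=
  if i < L then RRefM L k t i else if i < 2 * L then QwRef L k t (i - L) else if i < 3 * L then mkRef L k t (i - 2 * L) else dRef L k t (i - 3 * L)

/-! ### The pieces -/

/-- The pieces. [cite: Vollmer1999, §1.2] -/
def pieces (L : ℕ) (k : ℕ) : Piece :=
  if k ≤ L then ⟨Mul.mulPT L, 2 * L + 1, wM L k⟩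
  else if k = L + 1 then ⟨Mul.mulPT L, 2 * L + 1, wMP L⟩
  else if k ≤ 2 * L + 1 then ⟨ModMulU.maskRow L, L + 1, wQ L (k - L - 2)⟩
  else if k < iF L then ⟨Adder.addT false L, 2 * L, wU L ((k - (2 * L + 2)) / (L + 1)) ((k - (2 * L + 2)) % (L + 1))⟩
  else ⟨MFI.mfiT L, 4 * L, wF L ((k - iF L) / L) ((k - iF L) % L)⟩

/-- Closed-form offsets. [folklore] -/
def offF (L : ℕ) (k : ℕ) : ℕ :=
  if k ≤ L + 1 then k * MLn L else if k ≤ 2 * L + 2 then oQ L + (k - L - 2) * L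
  else if k ≤ iF L then oU L + (k - (2 * L + 2)) * MFI.A L else oF L + (k - iF L) * MF L

/-- **The commutativity kit.** [cite: Vollmer1999, §1.2] -/
def commPT (L : ℕ) : Template := layout (pieces L) (NP L)

/-- The length of piece `k`. [folklore] -/
theorem length_piece (k : ℕ) :
    (pieces L k).T.length = if k ≤ L + 1 then MLn L else if k ≤ 2 * L + 1 then L else if k < iF L then MFI.A L else MF L := by
  unfold pieces
  by_cases h1 : k ≤ L
  · simp [h1, show k ≤ L + 1 by omega, Mul.length_mulPT, MLn]
  by_cases h2 : k = L + 1
  · subst h2; simp [Mul.length_mulPT, MLn]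
  have g : ¬k ≤ L + 1 := by omega
  simp only [h1, h2, g, if_false]
  by_cases h3 : k ≤ 2 * L + 1
  · simp [h3]
  simp only [h3, if_false]
  by_cases h4 : k < iF L
  · simp [h4, MFI.A]
  · simp [h4, MFI.length_mfiT, MF]

/-- The closed form steps like the lengths. [folklore] -/
theorem offF_succ (k : ℕ) (hk : k < NP L) : offF L (k + 1) = offF L k + (pieces L k).T.length := by
  rw [length_piece]
  have hiF : 2 * L + 2 ≤ iF L := by unfold iF; omega
  have hNP : NP L = iF L + L * L := rfl
  by_cases h1 : k ≤ L
  · have g1 : k + 1 ≤ L + 1 := by omega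
    have g2 : k ≤ L + 1 := by omega
    simp only [offF, g1, g2, if_true]; ring
  by_cases h2 : k = L + 1
  · subst h2
    simp only [offF, show ¬(L + 1 + 1 ≤ L + 1) by omega, show L + 1 + 1 ≤ 2 * L + 2 by omega, le_refl, if_true, if_false]
    rw [show L + 1 + 1 - L - 2 = 0 by omega]; unfold oQ; ring
  have g : ¬k ≤ L + 1 := by omega
  have g' : ¬k + 1 ≤ L + 1 := by omega
  by_cases h3 : k ≤ 2 * L + 1
  · have g3 : k + 1 ≤ 2 * L + 2 := by omega
    have g4 : k ≤ 2 * L + 2 := by omega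
    simp only [offF, g, g', g3, g4, h3, if_true, if_false]
    rw [show k + 1 - L - 2 = (k - L - 2) + 1 by omega]; ring
  have g3 : ¬k ≤ 2 * L + 1 := by omega
  by_cases h4 : k < iF L
  · have g5 : k + 1 ≤ iF L := by omega
    by_cases e : k = 2 * L + 2
    · subst e
      simp only [offF, g, g', g3, h4, g5, if_true, if_false, show ¬(2 * L + 2 + 1 ≤ 2 * L + 2) by omega, le_refl]
      rw [show 2 * L + 2 - L - 2 = L by omega, show 2 * L + 2 + 1 - (2 * L + 2) = 1 by omega]; unfold oU; ring
    · have g6 : ¬(k + 1 ≤ 2 * L + 2) := by omega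
      have g7 : ¬(k ≤ 2 * L + 2) := by omega
      have g8 : k ≤ iF L := by omega
      simp only [offF, g, g', g3, h4, g5, g6, g7, g8, if_true, if_false]
      rw [show k + 1 - (2 * L + 2) = (k - (2 * L + 2)) + 1 by omega]; ring
  · have g6 : ¬(k + 1 ≤ 2 * L + 2) := fun h => h4 (by omega)
    have g7 : ¬(k ≤ 2 * L + 2) := fun h => h4 (by unfold iF; nlinarith [Nat.zero_le (L * (L + 1))])
    by_cases e : k = iF L
    · subst e
      simp only [offF, g, g', g3, h4, g6, g7, le_refl, if_true, if_false, show ¬(iF L + 1 ≤ iF L) by omega]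
      rw [show iF L + 1 - iF L = 1 by omega, show iF L - (2 * L + 2) = L * (L + 1) by unfold iF; omega]; unfold oF; ring
    · have g8 : ¬(k ≤ iF L) := by omega
      have g9 : ¬(k + 1 ≤ iF L) := by omega
      simp only [offF, g, g', g3, h4, g6, g7, g8, g9, if_false]
      rw [show k + 1 - iF L = (k - iF L) + 1 by omega]; ring

/-- **The offsets of the pieces are the closed forms.** [folklore] -/
theorem offset_pieces : ∀ k ≤ NP L, offset (pieces L) k = offF L k := by
  intro k hk
  induction k with
  | zero => simp [offF]
  | succ k ih => rw [offset_succ, ih (by omega), offF_succ L k (by omega)]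

/-! ### Well-formedness -/

/-- The closed-form offsets of the families. [folklore] -/
theorem offF_fam : (∀ k ≤ L + 1, offF L k = k * MLn L) ∧ (∀ k < L, offF L (L + 2 + k) = oQ L + k * L) ∧
    (∀ m < L * (L + 1), offF L (2 * L + 2 + m) = oU L + m * MFI.A L) ∧ (∀ m < L * L, offF L (iF L + m) = oF L + m * MF L) := by
  refine ⟨fun k hk => by unfold offF; rw [if_pos hk], fun k hk => ?_, fun m hm => ?_, fun m hm => ?_⟩
  · unfold offF; rw [if_neg (by omega), if_pos (by omega), show L + 2 + k - L - 2 = k by omega]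
  · rcases Nat.eq_zero_or_pos m with rfl | hm0
    · unfold offF; rw [if_neg (by omega), if_pos (by omega), show 2 * L + 2 + 0 - L - 2 = L by omega]; unfold oU; ring
    · unfold offF; rw [if_neg (by omega), if_neg (by omega), if_pos (by unfold iF; omega), Nat.add_sub_cancel_left]
  · rcases Nat.eq_zero_or_pos m with rfl | hm0
    · unfold offF; rw [if_neg (by unfold iF; omega), if_neg (by unfold iF; nlinarith), if_pos (by omega), Nat.add_zero,
        show iF L - (2 * L + 2) = L * (L + 1) by unfold iF; omega]; unfold oF; ring
    · unfold offF; rw [if_neg (by unfold iF; omega), if_neg (by unfold iF; nlinarith), if_neg (by omega), Nat.add_sub_cancel_left]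

/-- Basic offset facts. [folklore] -/
theorem off_facts : (L + 1) * MLn L + MLn L = oQ L ∧ oQ L + L * L = oU L ∧ oU L + L * (L + 1) * MFI.A L = oF L ∧
    (∀ t j : ℕ, t ≤ L → j < L → 1 ≤ t → (t - 1) * Mul.PS L + L + (2 * j + 1) < MLn L) ∧ (∀ t j : ℕ, t < L → j < L → t * Mul.PS L + j < MLn L) := by
  refine ⟨by unfold oQ; ring, rfl, rfl, fun t j ht hj ht1 => ?_, fun t j ht hj => ?_⟩
  · have : (t - 1) * Mul.PS L + Mul.PS L ≤ L * Mul.PS L := by rw [← Nat.succ_mul]; exact Nat.mul_le_mul_right _ (by omega)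
    unfold MLn; unfold Mul.PS at this ⊢; omega
  · have : t * Mul.PS L + Mul.PS L ≤ L * Mul.PS L := by rw [← Nat.succ_mul]; exact Nat.mul_le_mul_right _ ht
    unfold MLn; unfold Mul.PS at this ⊢; omega

/-- A reference predicate: inputs below `2L + 1`, gates below `off`. [folklore] -/
def ROK (off : ℕ) (r : ℕ ⊕ ℕ) : Prop := (∀ a, r = Sum.inl a → a < 2 * L + 1) ∧ (∀ g, r = Sum.inr g → g < off)

variable {L}

/-- `ROK` of the references. [folklore] -/
theorem rok_refs {off : ℕ} :
    (∀ a < 2 * L + 1, ROK L off (Sum.inl a)) ∧ (∀ k t j, k ≤ L → t ≤ L → j < L → oQ L ≤ off → ROK L off (RRefM L k t j)) ∧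
    (∀ k j, k < L → j < L → oU L ≤ off → ROK L off (gRef L k j)) ∧ (∀ k t j, k < L → j < L → oU L ≤ off → ROK L off (QwRef L k t j)) ∧
    (∀ k t j, k < L → j < L → oU L ≤ off → ROK L off (dRef L k t j)) ∧ (∀ k t j, k ≤ L → t < L → j < L → oQ L ≤ off → ROK L off (mkRef L k t j)) := by
  obtain ⟨f1, f2, -, f4, f5⟩ := off_facts L
  have hinl : ∀ a < 2 * L + 1, ROK L off (Sum.inl a) := fun a ha => by unfold ROK; exact ⟨fun a' h => (by cases h; exact ha), fun g h => (by cases h)⟩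
  have hinr : ∀ g < off, ROK L off (Sum.inr g) := fun g hg => by unfold ROK; exact ⟨fun a h => (by cases h), fun g' h => (by cases h; exact hg)⟩
  have hM : ∀ k g, k ≤ L → g < MLn L → oQ L ≤ off → k * MLn L + g < off := fun k g hk hg hoff => by
    have : k * MLn L + MLn L ≤ (L + 1) * MLn L := by rw [← Nat.succ_mul]; exact Nat.mul_le_mul_right _ (by omega)
    omega
  have hG : ∀ k j, k < L → j < L → oU L ≤ off → oQ L + k * L + j < off := fun k j hk hj hoff => by
    have : k * L + L ≤ L * L := by rw [← Nat.succ_mul]; exact Nat.mul_le_mul_right _ hk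
    omega
  refine ⟨hinl, fun k t j hk ht hj hoff => ?_, fun k j hk hj hoff => hinr _ (hG k j hk hj hoff), fun k t j hk hj hoff => ?_, fun k t j hk hj hoff => ?_,
    fun k t j hk ht hj hoff => hinr _ (hM k _ hk (f5 t j ht hj) hoff)⟩
  · unfold RRefM; split_ifs with h0
    · exact hinl _ (by omega)
    · exact hinr _ (hM k _ hk (f4 t j ht hj (by omega)) hoff)
  · unfold QwRef; split_ifs with h0
    · exact hinr _ (hG k j hk hj hoff)
    · exact hinl _ (by omega)
  · unfold dRef; split_ifs with h0
    · exact hinr _ (hG k j hk hj hoff)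
    · exact hinl _ (by omega)

/-- The pieces by family. [folklore] -/
theorem pieces_fam : (∀ k ≤ L, pieces L k = ⟨Mul.mulPT L, 2 * L + 1, wM L k⟩) ∧ pieces L (L + 1) = ⟨Mul.mulPT L, 2 * L + 1, wMP L⟩ ∧
    (∀ k < L, pieces L (L + 2 + k) = ⟨ModMulU.maskRow L, L + 1, wQ L k⟩) ∧
    (∀ k < L, ∀ t ≤ L, pieces L (2 * L + 2 + (k * (L + 1) + t)) = ⟨Adder.addT false L, 2 * L, wU L k t⟩) ∧
    (∀ k < L, ∀ t < L, pieces L (iF L + (k * L + t)) = ⟨MFI.mfiT L, 4 * L, wF L k t⟩) := by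
  refine ⟨fun k hk => by unfold pieces; rw [if_pos hk], by unfold pieces; rw [if_neg (by omega), if_pos rfl], fun k hk => ?_, fun k hk t ht => ?_, fun k hk t ht => ?_⟩
  · unfold pieces; rw [if_neg (by omega), if_neg (by omega), if_pos (by omega), show L + 2 + k - L - 2 = k by omega]
  · have hm : k * (L + 1) + t < L * (L + 1) := by nlinarith
    unfold pieces; rw [if_neg (by omega), if_neg (by omega), if_neg (by omega), if_pos (by unfold iF; omega), Nat.add_sub_cancel_left,
      show (k * (L + 1) + t) / (L + 1) = k from by rw [Nat.add_comm, Nat.add_mul_div_right _ _ (by omega), Nat.div_eq_of_lt (by omega), Nat.zero_add],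
      show (k * (L + 1) + t) % (L + 1) = t from by rw [Nat.add_comm, Nat.add_mul_mod_self_right, Nat.mod_eq_of_lt (by omega)]]
  · have hL : 0 < L := by omega
    have hm : k * L + t < L * L := by nlinarith
    unfold pieces; rw [if_neg (by unfold iF; omega), if_neg (by unfold iF; nlinarith), if_neg (by unfold iF; nlinarith), if_neg (by omega), Nat.add_sub_cancel_left,
      show (k * L + t) / L = k from by rw [Nat.add_comm, Nat.add_mul_div_right _ _ hL, Nat.div_eq_of_lt ht, Nat.zero_add],
      show (k * L + t) % L = t from by rw [Nat.add_comm, Nat.add_mul_mod_self_right, Nat.mod_eq_of_lt ht]]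

/-- Every piece is well formed and well wired (`2L + 1` inputs). [cite: Vollmer1999, Def. 1.6] -/
theorem piece_ok : ∀ k < NP L, Piece.OK (pieces L) (2 * L + 1) k := by
  intro k hk
  obtain ⟨f1, f2, f3, -, -⟩ := off_facts L
  obtain ⟨oM, oQ', oU', oF'⟩ := offF_fam L
  obtain ⟨pM, pMP, pQ, pU, pF⟩ := pieces_fam (L := L)
  have rI := fun off a (h : a < 2 * L + 1) => (rok_refs (L := L) (off := off)).1 a h
  have rR := fun off k t j (hk : k ≤ L) (ht : t ≤ L) (hj : j < L) (h : oQ L ≤ off) => (rok_refs (L := L) (off := off)).2.1 k t j hk ht hj h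
  have rQw := fun off k t j (hk : k < L) (hj : j < L) (h : oU L ≤ off) => (rok_refs (L := L) (off := off)).2.2.2.1 k t j hk hj h
  have rD := fun off k t j (hk : k < L) (hj : j < L) (h : oU L ≤ off) => (rok_refs (L := L) (off := off)).2.2.2.2.1 k t j hk hj h
  have rMk := fun off k t j (hk : k ≤ L) (ht : t < L) (hj : j < L) (h : oQ L ≤ off) => (rok_refs (L := L) (off := off)).2.2.2.2.2 k t j hk ht hj h
  unfold Piece.OK
  rw [offset_pieces L k (by omega)]
  have okR : ∀ {off nI : ℕ} {T : Template} {w : ℕ → ℕ ⊕ ℕ}, T.WF nI → (∀ i < nI, ROK L off (w i)) →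
      T.WF nI ∧ ∀ i < nI, (∀ a, w i = Sum.inl a → a < 2 * L + 1) ∧ (∀ g, w i = Sum.inr g → g < off) := fun hT hw => ⟨hT, hw⟩
  have hNP : NP L = iF L + L * L := rfl
  by_cases h1 : k ≤ L
  · rw [pM k h1]; dsimp only
    refine okR (Mul.wf_mulPT L) fun i hi => ?_
    unfold wM; split_ifs <;> exact rI _ _ (by omega)
  by_cases h2 : k = L + 1
  · subst h2; rw [pMP]; dsimp only
    refine okR (Mul.wf_mulPT L) fun i hi => ?_
    unfold wMP; split_ifs <;> exact rI _ _ (by omega)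
  by_cases h3 : k ≤ 2 * L + 1
  · obtain ⟨k', rfl⟩ : ∃ k', k = L + 2 + k' := ⟨k - L - 2, by omega⟩
    rw [pQ k' (by omega)]; dsimp only
    refine okR (ModMulU.wf_maskRow L) fun j hj => ?_
    unfold wQ; split_ifs <;> exact rI _ _ (by omega)
  by_cases h4 : k < iF L
  · obtain ⟨m, rfl⟩ : ∃ m, k = 2 * L + 2 + m := ⟨k - (2 * L + 2), by omega⟩
    have hm : m < L * (L + 1) := by unfold iF at h4; omega
    have hL : 0 < L := Nat.pos_of_ne_zero (by rintro rfl; simp at hm)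
    obtain ⟨k', t, hk', ht, rfl⟩ : ∃ k' t, k' < L ∧ t ≤ L ∧ m = k' * (L + 1) + t :=
      ⟨m / (L + 1), m % (L + 1), (Nat.div_lt_iff_lt_mul (by omega)).2 (by nlinarith), Nat.lt_succ_iff.1 (Nat.mod_lt _ (by omega)),
        (Nat.div_add_mod' m (L + 1)).symm ▸ by ring⟩
    rw [pU k' hk' t ht, oU' _ hm]; dsimp only
    refine okR (Adder.wf_addT false L) fun j hj => ?_
    have hoff : oQ L ≤ oU L + (k' * (L + 1) + t) * MFI.A L := by rw [← f2]; omega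
    unfold wU; split_ifs with hjL
    · exact rR _ _ _ _ (by omega) ht hjL hoff
    · exact rQw _ _ _ _ hk' (by omega) (Nat.le_add_right _ _)
  · obtain ⟨m, rfl⟩ : ∃ m, k = iF L + m := ⟨k - iF L, by omega⟩
    have hm : m < L * L := by omega
    have hL : 0 < L := Nat.pos_of_ne_zero (by rintro rfl; simp at hm)
    obtain ⟨k', t, hk', ht, rfl⟩ : ∃ k' t, k' < L ∧ t < L ∧ m = k' * L + t :=
      ⟨m / L, m % L, (Nat.div_lt_iff_lt_mul hL).2 hm, Nat.mod_lt _ hL, (Nat.div_add_mod' m L).symm ▸ by ring⟩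
    rw [pF k' hk' t ht, oF' _ hm]; dsimp only
    refine okR (MFI.wf_mfiT L) fun i hi => ?_
    have hoffU : oU L ≤ oF L + (k' * L + t) * MF L := by rw [← f3]; exact (Nat.le_add_right _ _).trans (Nat.le_add_right _ _)
    have hoffQ : oQ L ≤ oF L + (k' * L + t) * MF L := by rw [← f2] at hoffU; omega
    unfold wF; split_ifs
    · exact rR _ _ _ _ (by omega) (by omega) (by omega) hoffQ
    · exact rQw _ _ _ _ hk' (by omega) hoffU
    · exact rMk _ _ _ _ (by omega) ht (by omega) hoffQ
    · exact rD _ _ _ _ hk' (by omega) hoffU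

/-- **The kit is well formed** (`2L + 1` inputs). [cite: Vollmer1999, Def. 1.6] -/
theorem wf_commPT : (commPT L).WF (2 * L + 1) := wf_layout (pieces L) piece_ok

/-! ### Views -/

section Views

variable (L : ℕ) (o : Occ)

/-- The zero gate. [folklore] -/
def zz : ℕ := o.inp (2 * L)
/-- The multipliers `M_k` (`k ≤ L`). [folklore] -/
def MQ (k : ℕ) : Occ := pieceOcc (o.inst (2 * L + 1)) (pieces L) k
/-- The multiplier `M' = M(b, a)`. [folklore] -/
def MP : Occ := pieceOcc (o.inst (2 * L + 1)) (pieces L) (L + 1)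
/-- The gates `g_{k,j} = a_k ∧ (b << k)_j`. [folklore] -/
def g (k j : ℕ) : ℕ := o.base + (oQ L + k * L + j)
/-- The word `b << k`. [folklore] -/
def bsh (k j : ℕ) : ℕ := if k ≤ j then o.inp (L + (j - k)) else o.inp (2 * L)
/-- The definition line of `g_{k,j}`. [folklore] -/
def qDef (k j : ℕ) : PropForm ℕ := biimp (var (g L o k j)) (conj (var (o.inp k)) (var (bsh L o k j)))
/-- The word `Qw_{k,t}`: `g_{k,j}` for `k ≤ j < k + t`, else zero. [folklore] -/
def Qw (k t j : ℕ) : ℕ := if k ≤ j ∧ j < k + t then g L o k j else o.inp (2 * L)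
/-- The one-hot word `δw_{k,t}` of `g_{k,k+t}`. [folklore] -/
def dw (k t j : ℕ) : ℕ := if j = k + t then g L o k j else o.inp (2 * L)
/-- The adders `U_{k,t} = R_t(M_k) + Qw_{k,t}`. [folklore] -/
def U (k t : ℕ) : Adder.View := ⟨o.base + (oU L + (k * (L + 1) + t) * MFI.A L), Mul.Rw L (MQ L o k) t, Qw L o k t⟩
/-- The interchange kits `F_{k,t}`. [folklore] -/
def FQ (k t : ℕ) : Occ := pieceOcc (o.inst (2 * L + 1)) (pieces L) (iF L + (k * L + t))

/-- All pieces of the commutativity kit are available. [folklore] -/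
structure KAvail (K : PropForm ℕ) (Γ : Set (PropForm ℕ)) : Prop where
  /-- `M_k` -/
  hM : ∀ k ≤ L, (MQ L o k).Avail (Mul.mulPT L) (2 * L + 1) K Γ
  /-- `M'` -/
  hMP : (MP L o).Avail (Mul.mulPT L) (2 * L + 1) K Γ
  /-- `g_{k,j}` -/
  hQ : ∀ k < L, ∀ j < L, ctx K (qDef L o k j) ∈ Γ
  /-- `U_{k,t}` -/
  hU : ∀ k < L, ∀ t ≤ L, (U L o k t).Avail K Γ false L
  /-- `F_{k,t}` -/
  hF : ∀ k < L, ∀ t < L, (FQ L o k t).Avail (MFI.mfiT L) (4 * L) K Γ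

end Views

variable {o : Occ} {K : PropForm ℕ} {Γ : Set (PropForm ℕ)}

/-- The base of the occurrence of piece `k`. [folklore] -/
theorem base_q {k : ℕ} (hk : k ≤ NP L) : (pieceOcc (o.inst (2 * L + 1)) (pieces L) k).base = o.base + offF L k := by
  simp [pieceOcc, offset_pieces L k hk]

/-- The bases and inputs of the multipliers. [folklore] -/
theorem MQ_facts {k : ℕ} (hk : k ≤ L) :
    (MQ L o k).base = o.base + k * MLn L ∧ (∀ i < L, (MQ L o k).inp i = if i < k then o.inp i else zz L o) ∧
    (∀ i < L, (MQ L o k).inp (L + i) = o.inp (L + i)) ∧ (MQ L o k).inp (2 * L) = zz L o := by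
  have pk := (pieces_fam (L := L)).1 k hk
  have e : MQ L o k = pieceOcc (o.inst (2 * L + 1)) (pieces L) k := rfl
  have hNP : k ≤ NP L := by unfold NP iF; nlinarith
  refine ⟨by rw [e, base_q hNP, (offF_fam L).1 k (by omega)], fun i hi => ?_, fun i hi => ?_, ?_⟩
  · rw [e, inp_pieceOcc, pk]; dsimp only; unfold wM; rw [if_pos hi]; split_ifs <;> exact Occ.ref_inl o (by omega)
  · rw [e, inp_pieceOcc, pk]; dsimp only; unfold wM; rw [if_neg (by omega), if_pos (by omega)]; exact Occ.ref_inl o (by omega)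
  · rw [e, inp_pieceOcc, pk]; dsimp only; unfold wM; rw [if_neg (by omega), if_neg (by omega)]; exact Occ.ref_inl o (by omega)

/-- The base and inputs of `M'`. [folklore] -/
theorem MP_facts : (MP L o).base = o.base + (L + 1) * MLn L ∧ (∀ i < L, (MP L o).inp i = o.inp (L + i)) ∧
    (∀ i < L, (MP L o).inp (L + i) = o.inp i) ∧ (MP L o).inp (2 * L) = zz L o := by
  have pk := (pieces_fam (L := L)).2.1
  have e : MP L o = pieceOcc (o.inst (2 * L + 1)) (pieces L) (L + 1) := rfl
  have hNP : L + 1 ≤ NP L := by unfold NP iF; nlinarith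
  refine ⟨by rw [e, base_q hNP, (offF_fam L).1 (L + 1) le_rfl], fun i hi => ?_, fun i hi => ?_, ?_⟩
  · rw [e, inp_pieceOcc, pk]; dsimp only; unfold wMP; rw [if_pos hi]; exact Occ.ref_inl o (by omega)
  · rw [e, inp_pieceOcc, pk]; dsimp only; unfold wMP; rw [if_neg (by omega), if_pos (by omega), Nat.add_sub_cancel_left]; exact Occ.ref_inl o (by omega)
  · rw [e, inp_pieceOcc, pk]; dsimp only; unfold wMP; rw [if_neg (by omega), if_neg (by omega)]; exact Occ.ref_inl o (by omega)

/-- The references resolve. [folklore] -/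
theorem ref_words {k t j : ℕ} (hk : k ≤ L) (_hj : j < L) :
    (o.inst (2 * L + 1)).ref (RRefM L k t j) = Mul.Rw L (MQ L o k) t j ∧ (o.inst (2 * L + 1)).ref (QwRef L k t j) = Qw L o k t j ∧
    (o.inst (2 * L + 1)).ref (dRef L k t j) = dw L o k t j ∧ (o.inst (2 * L + 1)).ref (mkRef L k t j) = Mul.msk L (MQ L o k) t j := by
  obtain ⟨eb, -, -, e2⟩ := MQ_facts (L := L) (o := o) hk
  refine ⟨?_, ?_, ?_, ?_⟩
  · unfold RRefM Mul.Rw; split_ifs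
    · rw [Occ.ref_inl o (by omega)]; exact e2.symm
    · rw [Occ.ref_inr, eb]; show o.base + _ = _; simp only [Nat.add_assoc]
  · unfold QwRef Qw; split_ifs
    · rw [gRef, Occ.ref_inr]; rfl
    · exact Occ.ref_inl o (by omega)
  · unfold dRef dw; split_ifs
    · rw [gRef, Occ.ref_inr]; rfl
    · exact Occ.ref_inl o (by omega)
  · unfold mkRef Mul.msk; rw [Occ.ref_inr, eb]; show o.base + _ = _; simp only [Nat.add_assoc]

/-- **All pieces of an available occurrence of the commutativity kit are available.** [folklore] -/
theorem avail_ofOcc (ho : o.Avail (commPT L) (2 * L + 1) K Γ) : KAvail L o K Γ := by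
  obtain ⟨pM, pMP, pQ, pU, pF⟩ := pieces_fam (L := L)
  have O := offF_fam L
  have hPc : ∀ {k : ℕ} (hk : k < NP L) {T : Template} {nI : ℕ} {w} (pk : pieces L k = ⟨T, nI, w⟩) (hwf : T.WF nI),
      (pieceOcc (o.inst (2 * L + 1)) (pieces L) k).Avail T nI K Γ := by
    intro k hk T nI w pk hwf
    have := Inst.DefsAvail.piece ho (k := k) hk (by rw [pk]; exact hwf); rw [pk] at this; exact this
  have hNP : NP L = iF L + L * L := rfl
  refine ⟨fun k hk => hPc (by unfold NP iF; nlinarith) (pM k hk) (Mul.wf_mulPT L), hPc (by unfold NP iF; nlinarith) pMP (Mul.wf_mulPT L),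
    fun k hk j hj => ?_, fun k hk t ht => ?_, fun k hk t ht => ?_⟩
  · -- the gates `g_{k,j}`
    have pk := pQ k hk
    have hq : (pieceOcc (o.inst (2 * L + 1)) (pieces L) (L + 2 + k)).Avail (ModMulU.maskRow L) (L + 1) K Γ := hPc (by unfold NP iF; nlinarith) pk (ModMulU.wf_maskRow L)
    have := hq j (by rw [ModMulU.length_maskRow]; exact hj)
    rw [ModMulU.getElem_maskRow] at this
    have ew : ((pieceOcc (o.inst (2 * L + 1)) (pieces L) (L + 2 + k)).inst (L + 1)).wire j = g L o k j := by
      show o.base + offset (pieces L) (L + 2 + k) + j = _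
      rw [offset_pieces L _ (by unfold NP iF; nlinarith), O.2.1 k hk]; unfold g; simp only [Nat.add_assoc]
    have e0 : ((pieceOcc (o.inst (2 * L + 1)) (pieces L) (L + 2 + k)).inst (L + 1)).ref (Sum.inl 0) = o.inp k := by
      rw [Occ.ref_inl _ (by omega), inp_pieceOcc, pk]; dsimp only; unfold wQ; rw [if_pos rfl]; exact Occ.ref_inl o (by omega)
    have e1 : ((pieceOcc (o.inst (2 * L + 1)) (pieces L) (L + 2 + k)).inst (L + 1)).ref (Sum.inl (1 + j)) = bsh L o k j := by
      rw [Occ.ref_inl _ (by omega), inp_pieceOcc, pk]; dsimp only; unfold wQ bsh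
      rw [if_neg (by omega), show 1 + j - 1 = j by omega]; split_ifs <;> exact Occ.ref_inl o (by omega)
    simpa [Inst.body, Kind.body, Netlist.arg, ew, e0, e1, qDef] using this
  · -- the adders `U_{k,t}`
    have hm : k * (L + 1) + t < L * (L + 1) := by nlinarith
    have pk := pU k hk t ht
    have hq : (pieceOcc (o.inst (2 * L + 1)) (pieces L) (2 * L + 2 + (k * (L + 1) + t))).Avail (Adder.addT false L) (2 * L) K Γ :=
      hPc (by unfold NP iF; omega) pk (Adder.wf_addT false L)
    refine Adder.View.Avail.congr (Adder.avail_viewOf hq) ?_ (fun i hi => ?_) (fun i hi => ?_)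
    · show o.base + _ = o.base + offset (pieces L) _; rw [offset_pieces L _ (by unfold NP iF; omega), O.2.2.1 _ hm]
    · show Mul.Rw L (MQ L o k) t i = ((pieceOcc (o.inst (2 * L + 1)) (pieces L) _).inst (2 * L)).inputs.getD i 0
      rw [Occ.getD_inst _ (show i < 2 * L by omega)]; show _ = (pieceOcc _ _ _).inp i
      rw [inp_pieceOcc, pk]; dsimp only; unfold wU; rw [if_pos hi]; exact ((ref_words (t := t) hk.le hi).1).symm
    · show Qw L o k t i = ((pieceOcc (o.inst (2 * L + 1)) (pieces L) _).inst (2 * L)).inputs.getD (L + i) 0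
      rw [Occ.getD_inst _ (show L + i < 2 * L by omega)]; show _ = (pieceOcc _ _ _).inp (L + i)
      rw [inp_pieceOcc, pk]; dsimp only; unfold wU; rw [if_neg (by omega), Nat.add_sub_cancel_left]; exact ((ref_words (t := t) hk.le hi).2.1).symm
  · have hm : k * L + t < L * L := by nlinarith
    exact hPc (by unfold NP; omega) (pF k hk t ht) (MFI.wf_mfiT L)

/-- The inputs of `F_{k,t}`: `(R_t(M_k), Qw_{k,t}, mask_t(M_k), δw_{k,t})`. [folklore] -/
theorem FQ_inp {k t : ℕ} (hk : k < L) (ht : t < L) {i : ℕ} (hi : i < L) :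
    (FQ L o k t).inp i = Mul.Rw L (MQ L o k) t i ∧ (FQ L o k t).inp (L + i) = Qw L o k t i ∧
    (FQ L o k t).inp (2 * L + i) = Mul.msk L (MQ L o k) t i ∧ (FQ L o k t).inp (3 * L + i) = dw L o k t i := by
  have pk := (pieces_fam (L := L)).2.2.2.2 k hk t ht
  have e : FQ L o k t = pieceOcc (o.inst (2 * L + 1)) (pieces L) (iF L + (k * L + t)) := rfl
  obtain ⟨r1, r2, r3, r4⟩ := ref_words (L := L) (o := o) (k := k) (t := t) hk.le hi
  refine ⟨?_, ?_, ?_, ?_⟩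
  · rw [e, inp_pieceOcc, pk]; dsimp only; unfold wF; rw [if_pos hi]; exact r1
  · rw [e, inp_pieceOcc, pk]; dsimp only; unfold wF; rw [if_neg (by omega), if_pos (by omega), Nat.add_sub_cancel_left]; exact r2
  · rw [e, inp_pieceOcc, pk]; dsimp only; unfold wF; rw [if_neg (by omega), if_neg (by omega), if_pos (by omega), show 2 * L + i - 2 * L = i by omega]; exact r4
  · rw [e, inp_pieceOcc, pk]; dsimp only; unfold wF; rw [if_neg (by omega), if_neg (by omega), if_neg (by omega), show 3 * L + i - 3 * L = i by omega]; exact r3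

end Comm

end Plain

end Literature.Computability.MetaComplexity
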